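/-
Copyright: the b2b-balaban T⁴-continuum CRUX team, row NE7b OWNER lineage `t4-ne7b-p1` (gen 125). Project licence.
-/
import Summits.QuantumFields.BalabanUV.T4Continuum.Spine.NE7b.SupZdProfileNoLoss

/-!
# KERNEL ALGEBRA ON `ℤ^d`, X: THE RESPONSE `Σ′_{b′}N(b′,b₀)Ψ_{b′}(p)` IS LIPSCHITZ IN ITS TWO INGREDIENTS — for coarse kernels `N₁, N₂`
# (`|N₂| ≤ C_Ne^{−ν|b−c|₁}`, `|N₁ − N₂| ≤ L_Ne^{−ν_L|b−c|₁}`) and block columns `Ψ₁, Ψ₂` (`|Ψ₁| ≤ C_Ψe^{−μ|blk n q − c|₁}`,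
# `|Ψ₁ − Ψ₂| ≤ L_Ψe^{−μ|blk n q − c|₁}`) with `ν, ν_L < μ`: both response series converge absolutely and
# `|Σ′N₁Ψ₁ − Σ′N₂Ψ₂|(p) ≤ L_NC_ΨK_{μ−ν_L}e^{−ν_L|blk n p − b₀|₁} + C_NL_ΨK_{μ−ν}e^{−ν|blk n p − b₀|₁}` — the resolvent split
# `N₁Ψ₁ − N₂Ψ₂ = (N₁ − N₂)Ψ₁ + N₂(Ψ₁ − Ψ₂)` and (214)'s NO-LOSS convolution twice.  With (235) (`V`-Lipschitz of `Ψ^K`, `N_K`) it gives the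
# `V`-Lipschitz bound of the perturbed response `h^K` on `ℤ^d`; with (222)∕(223)'s `K`-bounds it re-derives (223) (row NE7b, node U5c; (214)
# BY NAME; [folklore])

Cell `pub-balaban`, sub-cell `t4`, spine estimate NE7b (`T4WeightBudget.RelWeightBound`; the cell's OWN estimate — NOT PRINTED in
[Bałaban 1983–89], NOT PROVED).  Crux-route work under `Spine/NE7b/` by the row OWNER (`t4-ne7b-p1` gen 125, file (245)) under FREEZE
(0)'s crux-prover clause; NOTHING of Bałaban's is named as a Lean object, valued or asserted; no `T4Continuum/Support` leaf typed; no `def`,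
no notation; zero `sorry`; no road object (pure kernel algebra).  Imports (BY NAME): the OWNER's (214) `…SupZdProfileNoLoss`
(`tsum_exp_conv_noLoss`; through it (27) `blk`), Mathlib's `Summable.of_norm_bounded`, `Summable.tsum_sub`, `norm_tsum_le_tsum_norm`.

WHY (located).  (235) made the `H + K` column's block columns and next-scale Hessians Lipschitz in the potential; the response
`h^K_{b₀} = Σ′N_K(b′,b₀)Ψ^K_{b′}` inherits it by the same split (223) used for the `K`-dependence.  Stated for ANY kernels with the displayed
bounds, so that (235)'s outputs (`L_Ψ = 2C_PK_{δ₀−μ}DC_Ψ` at rate `μ`, `L_N = C_N²·2C_PK_{δ₀−μ}DC_Ψ·K_{ν∕2}K_{ν∕4}` at rate `ν∕4`) plug in by name,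
and equally (222)'s `K`-bounds.

WHAT IS PROVED ([folklore]): §1 `conv_term_le` (one dominated series: summability and the no-loss bound); §2 THE END
**`response_lipschitz`**; §3 toy.

HONEST (what this is NOT).  Abstract kernel algebra; the covariance's `V`-Lipschitz bound ((225)'s pattern) is the sequel; nothing of the
torus; nothing of the covariant propagators of [B4]–[B6]; nothing of Bałaban's asserted.  BY-NAME EFFECT ON THE WALL: NONE.  NE7b NOT
PRINTED ∕ NOT PROVED; spine PROVED 0∕9; rung (B)+1 — the programme's measures remain FINITE-torus statements; NOT the mass gap, NOT Clay.
HONEST DEPENDENCY: continuum YM on T⁴ ⇐ BetaPertH ∧ nine spine estimates (0∕9 proved); BetaPertH ⇐ (D1) ∧ (D4) ∧ CAP+tail; G-an2-4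
gates asym, D1 and NE2∕3∕4.
-/

set_option autoImplicit false

noncomputable section

namespace Summit.QuantumFields.BalabanUV.T4Continuum.NE7b.SupZdKernelResponseLipschitz

open Real Filter Topology
open Literature.MathematicalPhysics.QuantumFieldTheory.Balaban1983to89
open B6QGQLower276 (X blk)
open SupZdProfileNoLoss (tsum_exp_conv_noLoss)

variable {d : ℕ}

/-! ## §1. One dominated series -/

/-- **ONE TERM OF THE SPLIT**: `|A(b′)| ≤ C_Ae^{−α|b′−b₀|₁}`, `|F(b′)| ≤ C_Fe^{−μ|x−b′|₁}` with `0 ≤ α < μ` ⟹ `Σ′_{b′}A(b′)F(b′)` converges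
absolutely and `|Σ′A·F| ≤ C_AC_FK_{μ−α}e^{−α|x−b₀|₁}` — (214)'s no-loss convolution. [folklore] -/
theorem conv_term_le {CA α CF μ : ℝ} (hα : 0 ≤ α) (hαμ : α < μ) (b₀ x : X d) (A F : X d → ℝ)
    (hA : ∀ b', |A b'| ≤ CA * exp (-(α * ∑ i, (((b' i - b₀ i).natAbs : ℕ) : ℝ))))
    (hF : ∀ b', |F b'| ≤ CF * exp (-(μ * ∑ i, (((x i - b' i).natAbs : ℕ) : ℝ)))) :
    Summable (fun b' : X d => A b' * F b') ∧
    |∑' b' : X d, A b' * F b'| ≤ CA * CF * (2 * (1 - exp (-(μ - α)))⁻¹) ^ d * exp (-(α * ∑ i, (((x i - b₀ i).natAbs : ℕ) : ℝ))) := by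
  obtain ⟨hs, hle⟩ := tsum_exp_conv_noLoss (d := d) hα hαμ b₀ x
  have hCA : 0 ≤ CA := by
    have h := (abs_nonneg _).trans (hA b₀)
    exact le_of_mul_le_mul_right (by rw [zero_mul]; exact h) (exp_pos _)
  have hCF : 0 ≤ CF := by
    have h := (abs_nonneg _).trans (hF x)
    exact le_of_mul_le_mul_right (by rw [zero_mul]; exact h) (exp_pos _)
  have hpt : ∀ b', |A b' * F b'| ≤ CA * CF * (exp (-(μ * ∑ i, (((x i - b' i).natAbs : ℕ) : ℝ)))
      * exp (-(α * ∑ i, (((b' i - b₀ i).natAbs : ℕ) : ℝ)))) := fun b' => by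
    rw [abs_mul]
    calc |A b'| * |F b'| ≤ (CA * exp (-(α * ∑ i, (((b' i - b₀ i).natAbs : ℕ) : ℝ))))
        * (CF * exp (-(μ * ∑ i, (((x i - b' i).natAbs : ℕ) : ℝ)))) := mul_le_mul (hA b') (hF b') (abs_nonneg _) (by positivity)
      _ = _ := by ring
  have hmaj : Summable fun b' : X d => CA * CF * (exp (-(μ * ∑ i, (((x i - b' i).natAbs : ℕ) : ℝ)))
      * exp (-(α * ∑ i, (((b' i - b₀ i).natAbs : ℕ) : ℝ)))) := hs.mul_left _
  have hsum : Summable (fun b' : X d => A b' * F b') := Summable.of_norm_bounded hmaj fun b' => by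
    rw [Real.norm_eq_abs]; exact hpt b'
  refine ⟨hsum, ?_⟩
  have h1 : |∑' b' : X d, A b' * F b'| ≤ ∑' b' : X d, |A b' * F b'| := by
    have := norm_tsum_le_tsum_norm hsum.norm
    simpa only [Real.norm_eq_abs] using this
  have h2 := hsum.abs.tsum_le_tsum hpt hmaj
  rw [tsum_mul_left] at h2
  calc |∑' b' : X d, A b' * F b'| ≤ CA * CF * ∑' b' : X d, exp (-(μ * ∑ i, (((x i - b' i).natAbs : ℕ) : ℝ)))
        * exp (-(α * ∑ i, (((b' i - b₀ i).natAbs : ℕ) : ℝ))) := h1.trans h2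
    _ ≤ CA * CF * ((2 * (1 - exp (-(μ - α)))⁻¹) ^ d * exp (-(α * ∑ i, (((x i - b₀ i).natAbs : ℕ) : ℝ)))) :=
        mul_le_mul_of_nonneg_left hle (by positivity)
    _ = _ := by ring

/-! ## §2. THE END: the response is Lipschitz in the kernel and in the columns -/

/-- **HEADLINE — THE RESPONSE IS LIPSCHITZ IN ITS INGREDIENTS**: coarse kernels `N₁, N₂` with `|N₂(b′,b₀)| ≤ C_Ne^{−ν|b′−b₀|₁}`,
`|N₁(b′,b₀) − N₂(b′,b₀)| ≤ L_Ne^{−ν_L|b′−b₀|₁}`, block columns with `|Ψ₁(b′,p)| ≤ C_Ψe^{−μ|blk n p − b′|₁}`, `|Ψ₁ − Ψ₂|(b′,p) ≤ L_Ψe^{−μ|blk n p − b′|₁}`,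
rates `0 < ν < μ`, `0 ≤ ν_L < μ` ⟹ both response series `Σ′N_j(b′,b₀)Ψ_j(b′,p)` converge absolutely and
`|Σ′N₁Ψ₁ − Σ′N₂Ψ₂|(p) ≤ L_NC_ΨK_{μ−ν_L}e^{−ν_L|blk n p − b₀|₁} + C_NL_ΨK_{μ−ν}e^{−ν|blk n p − b₀|₁}` — the split `(N₁ − N₂)Ψ₁ + N₂(Ψ₁ − Ψ₂)` and
§1 twice. [folklore] -/
theorem response_lipschitz (n : ℕ) {CN ν CΨ μ LN νL LΨ : ℝ} (hν : 0 < ν) (hνμ : ν < μ) (hνL : 0 ≤ νL) (hνLμ : νL < μ)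
    (N₁ N₂ Ψ₁ Ψ₂ : X d → X d → ℝ) (b₀ p : X d)
    (hN₂ : ∀ b', |N₂ b' b₀| ≤ CN * exp (-(ν * ∑ i, (((b' i - b₀ i).natAbs : ℕ) : ℝ))))
    (hNd : ∀ b', |N₁ b' b₀ - N₂ b' b₀| ≤ LN * exp (-(νL * ∑ i, (((b' i - b₀ i).natAbs : ℕ) : ℝ))))
    (hΨ₁ : ∀ b', |Ψ₁ b' p| ≤ CΨ * exp (-(μ * ∑ i, (((blk n p i - b' i).natAbs : ℕ) : ℝ))))
    (hΨd : ∀ b', |Ψ₁ b' p - Ψ₂ b' p| ≤ LΨ * exp (-(μ * ∑ i, (((blk n p i - b' i).natAbs : ℕ) : ℝ)))) :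
    Summable (fun b' : X d => N₁ b' b₀ * Ψ₁ b' p) ∧ Summable (fun b' : X d => N₂ b' b₀ * Ψ₂ b' p) ∧
    |∑' b' : X d, N₁ b' b₀ * Ψ₁ b' p - ∑' b' : X d, N₂ b' b₀ * Ψ₂ b' p|
      ≤ LN * CΨ * (2 * (1 - exp (-(μ - νL)))⁻¹) ^ d * exp (-(νL * ∑ i, (((blk n p i - b₀ i).natAbs : ℕ) : ℝ)))
        + CN * LΨ * (2 * (1 - exp (-(μ - ν)))⁻¹) ^ d * exp (-(ν * ∑ i, (((blk n p i - b₀ i).natAbs : ℕ) : ℝ))) := by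
  have hCN : 0 ≤ CN := by
    have h := (abs_nonneg _).trans (hN₂ b₀)
    exact le_of_mul_le_mul_right (by rw [zero_mul]; exact h) (exp_pos _)
  have hLN : 0 ≤ LN := by
    have h := (abs_nonneg _).trans (hNd b₀)
    exact le_of_mul_le_mul_right (by rw [zero_mul]; exact h) (exp_pos _)
  -- the bounds needed for the four series
  have hN₁ : ∀ b', |N₁ b' b₀| ≤ (CN + LN) * exp (-(min ν νL * ∑ i, (((b' i - b₀ i).natAbs : ℕ) : ℝ))) := by
    intro b'
    have h0 : (0 : ℝ) ≤ ∑ i, (((b' i - b₀ i).natAbs : ℕ) : ℝ) := by positivity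
    have e1 : exp (-(ν * ∑ i, (((b' i - b₀ i).natAbs : ℕ) : ℝ))) ≤ exp (-(min ν νL * ∑ i, (((b' i - b₀ i).natAbs : ℕ) : ℝ))) :=
      exp_le_exp.2 (neg_le_neg (mul_le_mul_of_nonneg_right (min_le_left _ _) h0))
    have e2 : exp (-(νL * ∑ i, (((b' i - b₀ i).natAbs : ℕ) : ℝ))) ≤ exp (-(min ν νL * ∑ i, (((b' i - b₀ i).natAbs : ℕ) : ℝ))) :=
      exp_le_exp.2 (neg_le_neg (mul_le_mul_of_nonneg_right (min_le_right _ _) h0))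
    calc |N₁ b' b₀| = |N₂ b' b₀ + (N₁ b' b₀ - N₂ b' b₀)| := by ring_nf
      _ ≤ |N₂ b' b₀| + |N₁ b' b₀ - N₂ b' b₀| := abs_add_le _ _
      _ ≤ CN * exp (-(min ν νL * ∑ i, (((b' i - b₀ i).natAbs : ℕ) : ℝ)))
          + LN * exp (-(min ν νL * ∑ i, (((b' i - b₀ i).natAbs : ℕ) : ℝ))) :=
          add_le_add ((hN₂ b').trans (mul_le_mul_of_nonneg_left e1 hCN)) ((hNd b').trans (mul_le_mul_of_nonneg_left e2 hLN))
      _ = _ := by ring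
  have hΨ₂ : ∀ b', |Ψ₂ b' p| ≤ (CΨ + LΨ) * exp (-(μ * ∑ i, (((blk n p i - b' i).natAbs : ℕ) : ℝ))) := fun b' =>
    calc |Ψ₂ b' p| = |Ψ₁ b' p - (Ψ₁ b' p - Ψ₂ b' p)| := by ring_nf
      _ ≤ |Ψ₁ b' p| + |Ψ₁ b' p - Ψ₂ b' p| := abs_sub _ _
      _ ≤ _ := by rw [add_mul]; exact add_le_add (hΨ₁ b') (hΨd b')
  have hmin0 : 0 ≤ min ν νL := le_min hν.le hνL
  have hminμ : min ν νL < μ := lt_of_le_of_lt (min_le_left _ _) hνμ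
  -- the four series
  obtain ⟨s11, -⟩ := conv_term_le hmin0 hminμ b₀ (blk n p) (fun b' => N₁ b' b₀) (fun b' => Ψ₁ b' p) hN₁ hΨ₁
  obtain ⟨s22, -⟩ := conv_term_le hν.le hνμ b₀ (blk n p) (fun b' => N₂ b' b₀) (fun b' => Ψ₂ b' p) hN₂ hΨ₂
  obtain ⟨sd1, bd1⟩ := conv_term_le hνL hνLμ b₀ (blk n p) (fun b' => N₁ b' b₀ - N₂ b' b₀) (fun b' => Ψ₁ b' p) hNd hΨ₁
  obtain ⟨sd2, bd2⟩ := conv_term_le hν.le hνμ b₀ (blk n p) (fun b' => N₂ b' b₀) (fun b' => Ψ₁ b' p - Ψ₂ b' p) hN₂ hΨd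
  refine ⟨s11, s22, ?_⟩
  -- the split
  have e : ∑' b' : X d, N₁ b' b₀ * Ψ₁ b' p - ∑' b' : X d, N₂ b' b₀ * Ψ₂ b' p
      = ∑' b' : X d, (N₁ b' b₀ - N₂ b' b₀) * Ψ₁ b' p + ∑' b' : X d, N₂ b' b₀ * (Ψ₁ b' p - Ψ₂ b' p) := by
    rw [← s11.tsum_sub s22, ← sd1.tsum_add sd2]
    exact tsum_congr fun b' => by ring
  rw [e]
  exact (abs_add_le _ _).trans (add_le_add bd1 bd2)

/-! ## §3. Toy -/

/-- Toy (`d = 1`, `n = 0`): with zero kernels and columns all four series vanish and the bound is trivial. -/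
example (b₀ p : X 1) :
    |∑' b' : X 1, (fun _ _ => (0 : ℝ)) b' b₀ * (fun _ _ => (0 : ℝ)) b' p
        - ∑' b' : X 1, (fun _ _ => (0 : ℝ)) b' b₀ * (fun _ _ => (0 : ℝ)) b' p|
      ≤ 0 * 0 * (2 * (1 - exp (-(1 - 0)))⁻¹) ^ 1 * exp (-(0 * ∑ i, (((blk 0 p i - b₀ i).natAbs : ℕ) : ℝ)))
        + 0 * 0 * (2 * (1 - exp (-(1 - 1 / 2)))⁻¹) ^ 1 * exp (-(1 / 2 * ∑ i, (((blk 0 p i - b₀ i).natAbs : ℕ) : ℝ))) :=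
  (response_lipschitz (d := 1) 0 (CN := 0) (ν := 1 / 2) (CΨ := 0) (μ := 1) (LN := 0) (νL := 0) (LΨ := 0) (by norm_num) (by norm_num)
    le_rfl (by norm_num) (fun _ _ => 0) (fun _ _ => 0) (fun _ _ => 0) (fun _ _ => 0) b₀ p
    (fun _ => by simp) (fun _ => by simp) (fun _ => by simp) (fun _ => by simp)).2.2

end Summit.QuantumFields.BalabanUV.T4Continuum.NE7b.SupZdKernelResponseLipschitz
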